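import Summits.KontsevichZagierPeriods.Zeta5Search.Certificates.Zudilin2002Rates3
import Summits.KontsevichZagierPeriods.Zeta5Search.BrickPropositionHTwo
import HarnessLib

/-!
# ζ(5) search — Zudilin's 2002 row as an UNCONDITIONAL `RowCertificate (zetaValue 5)` (cell `pub-zeta5`, seat ct-1 g43)

HONEST FRAMING: systematic search; no irrationality claim unless certified.

`Certificates/Zudilin2002Rates3.lean` (certifier cert-1) built Zudilin's 2002 family as `zudilinRow h : RowCertificate
(zetaValue 5)` CONDITIONALLY on the cited integrality `h : Zudilin2002.integrality` (`4Dₙ²qₙ, 4Dₙ⁷pₙ, 4Dₙ⁵p̃ₙ ∈ ℤ`,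
Mat. Zametki **72** (2002), Sect. 2 (14)–(15)).  That fact is now a THEOREM of the tree
(`BrickPropositionHTwo.integrality_holds`, seat ct-1 g43, through ct-1 g39–g42's `2`-adic chain), so the arithmetic tier is
unconditional: this file records the instantiated statements, nothing more.

* `zudilinRow_denomRate` — the unconditional row `zudilinRow integrality_holds` has effective denominators `4·lcm(1..n)⁷`,
  `δ = 7`;
* **`zudilinRow_margin_mem_unconditional`** — `margin = log λ − log ν − 7 ∈ (−5.9141, −5.9137)`: a NEAR-MISS (negative
  margin: NO irrationality consequence — `RowCertificate.irrational` needs `0 < margin`);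
* **`zudilinRow_worthiness_mem_unconditional`** — `γ ∈ (0.599, 0.600)` (exact `0.59960…`), far below the printed record
  `0.86597135` of Brown–Zudilin 2022, which is UNMOVED;
* `exists_rowCertificate_zetaFive` — hence `∃ C : RowCertificate (zetaValue 5)` with `δ = 7` and these brackets, with no
  hypothesis.

Nothing here bears on the irrationality of `ζ(5)`; the MODEL `δ = 5` of `SymmetricRow` (worthiness `0.778`) is a different,
unproved denominator statement.  Theorems only (0 `def`).
-/

noncomputable section

open Set
open Literature.NumberTheory.Irrationality.Zudilin2002 (integrality)
open Literature.NumberTheory.Transcendental (zetaValue)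
open Summit.KontsevichZagierPeriods.Zeta5Search.BrickPropositionHTwo (integrality_holds)

namespace Summit.KontsevichZagierPeriods.Zeta5Search.Certificates

namespace Zudilin2002Rates3

/-- The unconditional row has the effective denominators `4·lcm(1..n)⁷` and `δ = 7`. -/
theorem zudilinRow_denomRate :
    (zudilinRow integrality_holds).denomRate = 7 ∧ ∀ n, (zudilinRow integrality_holds).denom n = 4 * Nat.lcmUpto n ^ 7 :=
  ⟨rfl, fun _ => rfl⟩

/-- **`−5.9141 < μ₁ < −5.9137` UNCONDITIONALLY** for Zudilin's 2002 row (`μ₁ = log λ − log ν − 7`, exact `−5.91391…`): a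
near-miss with negative margin — no irrationality consequence. [cite: Zudilin2002Zeta5, Sect. 2 (14)–(15)] -/
theorem zudilinRow_margin_mem_unconditional :
    (-(59141 / 10000) : ℝ) < (zudilinRow integrality_holds).margin ∧
      (zudilinRow integrality_holds).margin < (-(59137 / 10000) : ℝ) :=
  zudilinRow_margin_mem integrality_holds

/-- **`0.599 < γ < 0.600` UNCONDITIONALLY** for Zudilin's 2002 row (exact `0.59960…`; the Brown–Zudilin 2022 record
`0.86597135` is unmoved). [cite: Zudilin2002Zeta5, Sect. 2 (14)–(15)] -/
theorem zudilinRow_worthiness_mem_unconditional :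
    (599 / 1000 : ℝ) < (zudilinRow integrality_holds).worthiness ∧
      (zudilinRow integrality_holds).worthiness < (600 / 1000 : ℝ) :=
  zudilinRow_worthiness_mem integrality_holds

/-- The margin of the unconditional row is NEGATIVE (so `RowCertificate.irrational` does not apply). -/
theorem zudilinRow_margin_neg : (zudilinRow integrality_holds).margin < 0 :=
  zudilinRow_margin_mem_unconditional.2.trans (by norm_num)

/-- **An unconditional order-3 row certificate for `ζ(5)` exists in the tree**: denominators exponent `δ = 7`, analytic tier
`zudilinRateCertificate`, margin in `(−5.9141, −5.9137)`, worthiness in `(0.599, 0.600)` — Zudilin's 2002 family with his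
integrality (14)–(15) now proved. -/
theorem exists_rowCertificate_zetaFive :
    ∃ C : RowCertificate (zetaValue 5), C.toRateCertificate = zudilinRateCertificate ∧ C.denomRate = 7 ∧
      (-(59141 / 10000) : ℝ) < C.margin ∧ C.margin < (-(59137 / 10000) : ℝ) ∧
      (599 / 1000 : ℝ) < C.worthiness ∧ C.worthiness < (600 / 1000 : ℝ) :=
  ⟨zudilinRow integrality_holds, rfl, rfl, zudilinRow_margin_mem_unconditional.1, zudilinRow_margin_mem_unconditional.2,
    zudilinRow_worthiness_mem_unconditional.1, zudilinRow_worthiness_mem_unconditional.2⟩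

end Zudilin2002Rates3

end Summit.KontsevichZagierPeriods.Zeta5Search.Certificates
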